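import Literature.NumberTheory.GaloisRepresentations.LubinTateComparisonDerivation
import Literature.NumberTheory.GaloisRepresentations.LubinTateColemanLogDeriv
import HarnessLib

/-!
# A formal group with an endomorphism `f ∈ 𝔉_π` IS `F_f`, and the invariant derivatives at the origin do
# not depend on the Lubin–Tate model: `[X⁰] D_f^k (h ∘ [1]_{f′→f}) = [X⁰] D_{f′}^k h`

Topic `NumberTheory/GaloisRepresentations`; namespace `Literature.NumberTheory.GaloisRepresentations.LubinTate`
(sequel of `LubinTate.lean` — `ltF`, `hom`, `eq_limit` — and of `LubinTateComparisonDifferential.lean` /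
`LubinTateComparisonDerivation.lean` — `invDiff_pullback`, `constantCoeff_iterate_derivation_subst_of_pullback`).

Lubin–Tate 1965, §1 Thm. 1: for `f, g ∈ 𝔉_π` there is a unique `[a]_{f,g}` with `f ∘ [a] = [a] ∘ g`,
`[a] ≡ aX`; `[1]_{f,g}` is an isomorphism of formal `𝒪`-modules `F_g ≅ F_f`.  De Shalit 1987, II §1.10:
the formal group `Ê` of the CM curve at a split prime, with its endomorphism `[π]`, is a (relative)
Lubin–Tate group — the identification used in II §4.3–4.9 to read the elliptic units' Coleman series.
This file records the two formal facts that make such an identification harmless for the measure lane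
of `Summits/BirchSwinnertonDyer` (cell `bsd-print-cf2`, brick B6; width seat `bsd-line-cf2c-w4` g11):

* §1 ★ `eq_ltF_of_compLeft_eq_compRight` — over any Lubin–Tate base, a two-variable series `G ≡ X₀ + X₁`
  without constant term that admits `f ∈ 𝔉_π` as an endomorphism (`f ∘ G = G ∘ (f × f)`) IS `F_f`
  (`LubinTate.eq_limit`): the abstract half of de Shalit II.1.10 / Lubin–Tate (4);
* §2 (over `𝒪[F]`, `f, f′ ∈ 𝔉_π` for the SAME uniformiser) ★ `invDiff_mul_derivative_hom_one` —
  **`ω_f · [1]′ = ω_{f′} ∘ [1]`** for the canonical isomorphism `[1] = [1]_{f′,f} : F_f → F_{f′}`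
  (`invDiff_pullback` with `φ = id`, `ε = 1`), hence ★★ `constantCoeff_iterate_derivation_subst_hom_one` —
  **`[X⁰](ω_f·d/dX)^[k] (h ∘ [1]) = [X⁰](ω_{f′}·d/dX)^[k] h`**: invariant derivatives at the origin — the
  Coates–Wiles values of `LubinTateCoatesWilesHom`, the moments of the measure lane — are the same in every
  Lubin–Tate model of `𝔉_π` (e.g. `Ê` with `[π]_Ê` versus `f′ = πX + X^q`).

Everything is a theorem; no definitions, no instances beyond the section-local attributes of the sibling
files, no named facts, no `sorry`.

## References

* [LubinTate1965] J. Lubin, J. Tate, *Formal complex multiplication in local fields*, Ann. of Math. 81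
  (1965), §1 (4), Thm. 1, Lemma 1.
* [deShalit1987] E. de Shalit, *Iwasawa theory of elliptic curves with complex multiplication*,
  Perspectives in Math. 3 (1987), Ch. I §1.2, §3.5 (p. 18), Ch. II §1.10 (p. 39), §4.3, §4.9.
-/

noncomputable section

open PowerSeries

namespace Literature.NumberTheory.GaloisRepresentations

namespace LubinTate

/-! ### §1 A formal group with an endomorphism `f ∈ 𝔉_π` is `F_f` -/

section Unique

variable {A : Type*} [CommRing A] {π : A} {q : ℕ} (hA : IsLTRing π q) {f : PowerSeries A}
  (hf : IsLTSeries π q f)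

/-- ★ **A formal group law admitting `f ∈ 𝔉_π` as an endomorphism IS the Lubin–Tate group `F_f`**: if
`G ∈ A⟦X₀, X₁⟧` has `G(0) = 0`, `G ≡ X₀ + X₁ (mod deg 2)` and `f ∘ G = G ∘ (f × f)`, then `G = F_f`
(uniqueness in Lubin–Tate's lemma). [cite: LubinTate1965, §1 (4), Lemma 1] [cite: deShalit1987, Ch. II §1.10 (p. 39)] -/
theorem eq_ltF_of_compLeft_eq_compRight {G : MvPowerSeries (Fin 2) A} (h0 : G.constantCoeff = 0)
    (h1 : ∀ i : Fin 2, MvPowerSeries.coeff (Finsupp.single i 1) G = 1) (h2 : compLeft f G = compRight f G) :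
    G = ltF hA hf :=
  eq_limit hA hf hf h0 h1 h2

end Unique

/-! ### §2 Invariant derivatives at the origin are the same in every Lubin–Tate model of `𝔉_π` -/

section Model

open ValuativeRel IsLocalRing Field IsNonarchimedeanLocalField

variable {F : Type} [Field F] [ValuativeRel F] [TopologicalSpace F] [IsNonarchimedeanLocalField F]

attribute [local instance] ltNormUniformSpace ltNormIsUniformAddGroup rk1 nF nE fintypeResidueField

variable {π : 𝒪[F]} (hπ : (valuation F).IsUniformizer (π : F))
  {f f' : PowerSeries (LTCoeff F)} (hf : IsLTSeries (LTCoeff.of F π) (residueFieldCard F) f)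
  (hf' : IsLTSeries (LTCoeff.of F π) (residueFieldCard F) f')

/-- `ω_g · g′ = π · ω_g ∘ g` for EVERY `g ∈ 𝔉_π` over `𝒪[F]` (`[π]_g = g`; the tree's
`invDiff_mul_derivative_ltSer` is the case `g = πX + X^q`). [cite: deShalit1987, Ch. I §3.5 (p. 18)] -/
theorem invDiff_mul_derivative_self {g : PowerSeries (LTCoeff F)}
    (hg : IsLTSeries (LTCoeff.of F π) (residueFieldCard F) g) :
    invDiff (isLTRing_LTCoeff hπ) hg * d⁄dX (LTCoeff F) g =
      C (LTCoeff.of F π) * (invDiff (isLTRing_LTCoeff hπ) hg).subst g := by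
  have h := invDiff_mul_derivative_hom (S := unitBall (ltField π 0)) (isLTRing_LTCoeff hπ) hg
    (algebraMap_LTCoeff_injective (ltField π 0)) (LTCoeff.of F π)
  rwa [hom_self_eq] at h

/-- ★ **The canonical isomorphism preserves the invariant differential**: for `f, f′ ∈ 𝔉_π` and
`[1] = [1]_{f′,f} : F_f → F_{f′}` (`f′ ∘ [1] = [1] ∘ f`, `[1] ≡ X`), `ω_f · [1]′ = ω_{f′} ∘ [1]`.
[cite: LubinTate1965, §1 Thm. 1] [cite: deShalit1987, Ch. I §1.2] -/
theorem invDiff_mul_derivative_hom_one :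
    invDiff (isLTRing_LTCoeff hπ) hf * d⁄dX (LTCoeff F) (hom (isLTRing_LTCoeff hπ) hf' hf 1) =
      (invDiff (isLTRing_LTCoeff hπ) hf').subst (hom (isLTRing_LTCoeff hπ) hf' hf 1) := by
  have hid : ∀ G : PowerSeries (LTCoeff F), G.map (RingHom.id (LTCoeff F)) = G := fun G => by
    ext n; rw [coeff_map, RingHom.id_apply]
  have h := invDiff_pullback (RingHom.id (LTCoeff F)) (π := LTCoeff.of F π) (u := 1) (ε := 1)
    (f := f) (f' := f') (ϖ := invDiff (isLTRing_LTCoeff hπ) hf) (ϖ' := invDiff (isLTRing_LTCoeff hπ) hf')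
    (ϑ := hom (isLTRing_LTCoeff hπ) hf' hf 1)
    hf.constantCoeff_eq_zero hf.coeff_one hf'.constantCoeff_eq_zero (by rw [one_mul]; exact hf'.coeff_one)
    (constantCoeff_invDiff _ _) (hid _) (invDiff_mul_derivative_self hπ hf)
    (constantCoeff_invDiff _ _) (hid _) (by rw [one_mul]; exact invDiff_mul_derivative_self hπ hf')
    (constantCoeff_hom _ _ _ _) (coeff_one_hom _ _ _ _) (by rw [RingHom.id_apply, one_mul])
    (by rw [hid]; exact (subst_hom (isLTRing_LTCoeff hπ) hf' hf 1).symm)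
    (isLTRing_LTCoeff hπ).eq_zero_of_mul_eq_zero
    (fun n hn x hx => by
      rw [one_mul, RingHom.id_apply] at hx
      have h1 : (1 - LTCoeff.of F π ^ n) * x = 0 := by linear_combination hx
      exact (IsUnit.mul_right_eq_zero ((isLTRing_LTCoeff hπ).isUnit_one_sub_pow n hn)).mp h1)
  rw [map_one, one_mul] at h
  exact h

/-- ★★ **Invariant derivatives at the origin are model-independent**: for every `h ∈ 𝒪[F]⟦X⟧`,
`[X⁰](ω_f · d/dX)^[k] (h ∘ [1]_{f′,f}) = [X⁰](ω_{f′} · d/dX)^[k] h` — the Coates–Wiles values / moments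
read in the model `F_f` of a series given in the model `F_{f′}` are unchanged.
[cite: LubinTate1965, §1 Thm. 1] [cite: deShalit1987, Ch. I §3.5 (11) (p. 18), Ch. II §1.10 (p. 39)] -/
theorem constantCoeff_iterate_derivation_subst_hom_one (k : ℕ) (h : PowerSeries (LTCoeff F)) :
    constantCoeff ((fun g : PowerSeries (LTCoeff F) =>
        invDiff (isLTRing_LTCoeff hπ) hf * d⁄dX (LTCoeff F) g)^[k] (h.subst (hom (isLTRing_LTCoeff hπ) hf' hf 1))) =
      constantCoeff ((fun g : PowerSeries (LTCoeff F) =>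
        invDiff (isLTRing_LTCoeff hπ) hf' * d⁄dX (LTCoeff F) g)^[k] h) := by
  have hpull : invDiff (isLTRing_LTCoeff hπ) hf * d⁄dX (LTCoeff F) (hom (isLTRing_LTCoeff hπ) hf' hf 1) =
      C (1 : LTCoeff F) * (invDiff (isLTRing_LTCoeff hπ) hf').subst (hom (isLTRing_LTCoeff hπ) hf' hf 1) := by
    rw [map_one, one_mul]; exact invDiff_mul_derivative_hom_one hπ hf hf'
  rw [constantCoeff_iterate_derivation_subst_of_pullback (constantCoeff_hom _ _ _ _) hpull, one_pow, one_mul]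

end Model

end LubinTate

end Literature.NumberTheory.GaloisRepresentations

end
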